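import Summits.HodgeConjecture.Ring2.FivefoldFactTwoShapes
import Literature.AlgebraicGeometry.HodgeTheory.GenericAbelianFivefoldPowersHodgeClasses
import HarnessLib

/-!
# Ring 2 (cell topic `Summits/HodgeConjecture/Ring2/`; seat `lit`, gen 68, R44): THE FIVEFOLD FACT HOLDS — Moonen–Zarhin 1999 Thm. 0.2 in codimension two, `MoonenZarhin1999_codimTwoHodgeClasses_abelianFivefold`, is a THEOREM of the tree; `HCUpToDim 5` modulo Markman ALONE is the row-four residual

HONEST FRAMING (cell `pub-hodge-ring2`, verbatim): research route conditional on HC_CM; not a corollary;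
Q11.4-sentence-2 already refuted in dim ≥ 3. `HC_CM` does NOT occur in this file. Markman's theorem
(`Markman2025_weilClasses_algebraic_abelianFourfold`) is a HYPOTHESIS of the single axis theorem of §2, never
asserted; no Ribet / Tankeev–Ribet named fact is used. Theorems only — no definition, no named fact, no `sorry`;
the NET effect on the Literature debt is `−1` (one named fact discharged, none introduced).

THE PRINT. B. Moonen, Yu. Zarhin, *Hodge classes on abelian varieties of low dimension*, Math. Ann. **315** (1999)
711–733, Thm. 0.2 with (2.8) and §5 (5.11): for a complex abelian FIVEFOLD `X`, «`B²(X) = D²(X) + Σ_α α^* B²(X')`»,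
the sum over the surjective homomorphisms `α : X ↠ X'` onto abelian fourfolds; §2 (2.6): «g = 5. As already stated
above, `Hg(X) = Sp_D(V,φ)` for all simple abelian 5-folds. The point here is that 5 is a prime number, since in fact
we have the following result, due to Tankeev»; Thm. (2.7) (Tankeev–Ribet).

THIS FILE (the §7 of `FivefoldFactTwoShapes` that its 400-line budget does not hold). Input: the Literature lane's
UNCONDITIONAL `GenericAbelianFivefoldPowersHodgeClasses` (lit g67–g68 R44: `Lie Hg = 𝔰𝔭₁₀` for `dim_ℚ H¹ = 10`,
`End_Hdg = ℚ` by the rank-ten Θ-subalgebra theorem `SymplecticThetaTen.wordDerAt_eq_zero_of_skew` — Hermitian-core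
dichotomy, `ℚ`-simplicity of `Lie Hg`, centroid descent, twin-`𝔰𝔩₂` parity —, then the invariant theory of `Sp`:
`AbelianVariety.isDivisorGenerated_of_fivefold_endRankOne`), and the localisation
`FivefoldFactTwoShapes.moonenZarhin1999_codimTwoHodgeClasses_abelianFivefold_iff_generic` (lit g66 R42–R43: the fact
is EQUIVALENT to its instances at the simple fivefolds with `End⁰ = ℚ`).
* §1 `isCodimTwoDivisorPullbackGenerated_of_generic` — shape (S1) is a THEOREM;
  **`isCodimTwoDivisorPullbackGenerated_of_dim_eq_five`** — EVERY complex abelian fivefold satisfies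
  `B² ⊆ D² + Σ_α α^* B²(X')`, POINTWISE and UNCONDITIONALLY;
  **`moonenZarhin1999_codimTwoHodgeClasses_abelianFivefold_holds`** — THE NAMED FACT HOLDS;
  `hodgeConjectureFor_of_dim_eq_five_of_isSimple` — the Hodge conjecture for EVERY SIMPLE complex abelian fivefold,
  unconditional; `genericSimpleFivefolds_hcOnClass` — the class target «simple fivefolds with `End⁰ = ℚ`» is CLOSED.
* §2 **`hcUpToDim_five_iff_rowFour_refined_of_markman`** — MODULO MARKMAN ALONE: `HCUpToDim 5 ↔ HC(row four
  refined)`: granted Markman's fourfold theorem, the only complex abelian varieties of dimension `≤ 5` on which the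
  Hodge conjecture is not a theorem of the tree are the simple non-CM FOURFOLDS of none of the four types Ribet
  `(3,1)`, minimal quaternion, maximal real multiplication, quartic CM `{(1,1),(2,0)}` (the rest of Moonen–Zarhin
  1995); `rowFourRefined_hcOnClass_of_hodgeConjecture` (on path).
* §3 (appended) **`moonenZarhin1999_hodgeClasses_abelian_dim_le_five_of_weilClassesFourfolds_of_fourfoldFact`** —
  the Literature named fact `MoonenZarhin1999_hodgeClasses_abelian_dim_le_five_of_weilClassesFourfolds` («Markman's
  Weil-class theorem for abelian fourfolds ⟹ every Hodge class on a complex abelian variety of dimension `≤ 5` is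
  algebraic», Moonen–Zarhin Thms. 0.1–0.2 with Markman Cor. 1.3) now FOLLOWS FROM THE FOURFOLD FACT
  `MoonenZarhin1999_codimTwoHodgeClasses_abelianFourfold` (Thm. 0.1, codimension two) ALONE: its second printed input,
  the fivefold fact, is `moonenZarhin1999_codimTwoHodgeClasses_abelianFivefold_holds` (the Literature lane's
  `…_of_printed`, whose other inputs — Lefschetz `(1,1)`, hard Lefschetz, Kodaira–Serre sections — are theorems).

THE CENSUS BEHIND THE FACT (all theorems of the tree; files under `Summits/HodgeConjecture/Ring2/` and
`Literature/AlgebraicGeometry/HodgeTheory/`): non-simple fivefolds — cases (a), (e), (f), (g) of Thm. 0.2 and the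
complementary rows (`NonSimpleFivefolds*`, `CaseGQuarticFieldClosed`, `CaseEA1Closed`; Literature R29–R41); CM
fivefolds (Pohlmann, `CMFivefoldsCodimTwo`); simple non-CM fivefolds by Albert type — I(5) (Ribet's Thm. 0,
`isDivisorGenerated_of_isTotallyReal`), IV(1) `(1,4)` (Ribet's Thm. 3 at type one, `isDivisorGenerated_of_ribetTypeOne`),
IV(1) `(2,3)` (`UnitaryThetaCore.eq_top_two_three'`, `RibetTypeTwoThreePowersHodgeClasses`, R43), I(1)
(`SymplecticThetaTen`, `GenericAbelianFivefoldPowersHodgeClasses`, R44).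

WHAT IS NOT CLAIMED: the row-four residual (Moonen–Zarhin 1995) is NOT closed; Markman is never asserted; the
identification of the pull-backs with the Weil classes `W_{k,α}` and the codimension-`3` part of Thm. 0.2 (1) are not
formalised; the FOURFOLD fact `MoonenZarhin1999_codimTwoHodgeClasses_abelianFourfold` (Thm. 0.1) is untouched.

## References
* [MoonenZarhin1999LowDim] B. Moonen, Yu. Zarhin, Math. Ann. 315 (1999) 711–733, Thm. 0.1, Thm. 0.2 with (2.8), §2
  (2.6), Thm. (2.7), §5 (5.11).
* [MoonenZarhin1995Duke] B. Moonen, Yu. Zarhin, Duke Math. J. 77 (1995), Thm. 2.4.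
* [Ribet1983] K. A. Ribet, Amer. J. Math. 105 (1983), Thms. 0–3.
* [Tankeev1983] S. G. Tankeev, Math. USSR-Izv. 20 (1983).
* [Deligne2000] P. Deligne, *The Hodge conjecture* (Clay problem description, 2000), §1.
* [claim: Markman2025SurveySecant, status: under-review] E. Markman, arXiv:2509.23403, Thm. 1.2.
-/

noncomputable section

open CategoryTheory CategoryTheory.Limits

namespace Summit.HodgeConjecture.Ring2.FivefoldFactHolds

open Literature.AlgebraicGeometry.Motives (AbelianVariety)
open Literature.AlgebraicGeometry.Motives.AbelianVariety
open Literature.AlgebraicGeometry.HodgeTheory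
open Literature.AlgebraicGeometry.ComplexMultiplication
open Literature.AlgebraicGeometry.Milne1999
open NumberField
open Literature.NumberTheory.Automorphic (IsQuaternionAlgebra)
open Summit.HodgeConjecture.HodgeConjecture.Ring2.ClassTargets
open Summit.HodgeConjecture.Ring2.FivefoldFactTwoShapes

variable {X : AbelianVariety ℂ}

/-! ### §1 Shape (S1) discharged: the fivefold fact HOLDS -/

/-- **Shape (S1) is a theorem**: a complex abelian FIVEFOLD with `End⁰(X) = ℚ` (`finrank_ℚ End⁰(X) = 1`) satisfies
`B² ⊆ D² + Σ_α α^* B²(X')` — indeed `B = D` on all its powers, the Literature lane's UNCONDITIONAL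
`AbelianVariety.isDivisorGenerated_of_fivefold_endRankOne` (`GenericAbelianFivefoldPowersHodgeClasses`: `Lie Hg = 𝔰𝔭₁₀`
by the rank-ten Θ-subalgebra theorem `SymplecticThetaTen.wordDerAt_eq_zero_of_skew`, then the invariant theory of
`Sp`; in print Moonen–Zarhin (2.6) «`Hg(X) = Sp_D(V,φ)` for all simple abelian 5-folds» / Ribet's Thm. 1 with
`E = ℚ`). [cite: MoonenZarhin1999LowDim, §2 (2.6) and Thm. (2.7)] [cite: Ribet1983, Thm. 1] -/
theorem isCodimTwoDivisorPullbackGenerated_of_generic (hX5 : X.dim = 5) (h1 : Module.finrank ℚ X.endAlgebra = 1) :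
    IsCodimTwoDivisorPullbackGenerated X :=
  (AbelianVariety.isDivisorGenerated_of_fivefold_endRankOne X h1 hX5).isCodimTwoDivisorPullbackGenerated

/-- **POINTWISE and UNCONDITIONAL: EVERY complex abelian fivefold `X` satisfies `B²(X) ⊆ D²(X) + Σ_α α^* B²(X')`**
(the sum over the surjective homomorphisms `α : X ↠ X'` onto abelian fourfolds) — the generic simple fivefolds by
(S1), every other fivefold by `isCodimTwoDivisorPullbackGenerated_of_dim_eq_five_of_not_generic`
(`FivefoldFactTwoShapes` §5). [cite: MoonenZarhin1999LowDim, Thm. 0.2 with (2.8) and §5 (5.11)] -/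
theorem isCodimTwoDivisorPullbackGenerated_of_dim_eq_five (hX5 : X.dim = 5) : IsCodimTwoDivisorPullbackGenerated X := by
  by_cases hs : X.IsSimple
  · by_cases h1 : Module.finrank ℚ X.endAlgebra = 1
    · exact isCodimTwoDivisorPullbackGenerated_of_generic hX5 h1
    · exact isCodimTwoDivisorPullbackGenerated_of_dim_eq_five_of_not_generic hX5 fun _ => h1
  · exact isCodimTwoDivisorPullbackGenerated_of_dim_eq_five_of_not_generic hX5 fun h => absurd h hs

/-- **MOONEN–ZARHIN 1999 Thm. 0.2, CODIMENSION TWO, IS A THEOREM OF THE TREE: the named fact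
`MoonenZarhin1999_codimTwoHodgeClasses_abelianFivefold` HOLDS** — for every complex abelian FIVEFOLD `A` and every
rational `(2,2)`-class `c ∈ H⁴(A, ℂ)`, `c` lies in the span of the products of divisor classes and of the pull-backs
of rational `(2,2)`-classes on abelian fourfolds along surjective homomorphisms: «`B²(X) = D²(X) + Σ_α α^* B²(X')`».
Assembled from the localisation `moonenZarhin1999_codimTwoHodgeClasses_abelianFivefold_iff_generic` (the fact is
equivalent to its instances at the simple fivefolds with `End⁰ = ℚ`) and (S1). `HC_CM` does not occur; Markman is
not used; no named fact is a hypothesis; nothing is admitted.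
[cite: MoonenZarhin1999LowDim, Thm. 0.2 with (2.8), §2 (2.6), Thm. (2.7) and §5 (5.11)] [cite: Ribet1983, Thms. 0–3] -/
theorem moonenZarhin1999_codimTwoHodgeClasses_abelianFivefold_holds :
    MoonenZarhin1999_codimTwoHodgeClasses_abelianFivefold :=
  moonenZarhin1999_codimTwoHodgeClasses_abelianFivefold_iff_generic.2 fun _ hX5 _ h1 =>
    isCodimTwoDivisorPullbackGenerated_of_generic hX5 h1

/-- **THE HODGE CONJECTURE FOR EVERY SIMPLE COMPLEX ABELIAN FIVEFOLD — UNCONDITIONAL** (the generic shape by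
`hodgeConjectureFor_of_fivefold_endRankOne`, every other simple fivefold by the Literature lane's
`hodgeConjectureFor_powSucc_of_isSimple_fivefold_of_finrank_ne_one`, R43). Moonen–Zarhin p. 715: «for g = 5 we always
find that Hg(X) = Sp_D(V,φ) … In particular the Hodge conjecture is true for all such Xⁿ».
[cite: MoonenZarhin1999LowDim, §2 p. 715, (2.6) and Thm. (2.7)] [cite: Deligne2000, §1] -/
theorem hodgeConjectureFor_of_dim_eq_five_of_isSimple (hX5 : X.dim = 5) (hs : X.IsSimple) :
    HodgeConjectureFor X.dim X.X := by
  by_cases h1 : Module.finrank ℚ X.endAlgebra = 1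
  · exact hodgeConjectureFor_of_fivefold_endRankOne X h1 hX5
  · exact hodgeConjectureFor_powSucc_of_isSimple_fivefold_of_finrank_ne_one hs hX5 h1 0

/-- **The class of simple fivefolds of generic shape `End⁰ = ℚ` is CLOSED, unconditionally** (it was «on path»
only: `FivefoldFactTwoShapes.genericSimpleFivefolds_hcOnClass_of_hodgeConjecture`).
[cite: MoonenZarhin1999LowDim, §2 (2.6) and Thm. (2.7)] [cite: Deligne2000, §1] -/
theorem genericSimpleFivefolds_hcOnClass :
    HCOnClass fun A => A.dim = 5 ∧ A.IsSimple ∧ Module.finrank ℚ A.endAlgebra = 1 :=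
  fun A hA => hodgeConjectureFor_of_fivefold_endRankOne A hA.2.2 hA.1

/-- **The class of ALL simple fivefolds is CLOSED, unconditionally.** [cite: MoonenZarhin1999LowDim, §2 p. 715 and Thm. (2.7)]
[cite: Deligne2000, §1] -/
theorem simpleFivefolds_hcOnClass : HCOnClass fun A => A.dim = 5 ∧ A.IsSimple :=
  fun _ hA => hodgeConjectureFor_of_dim_eq_five_of_isSimple hA.1 hA.2

/-! ### §2 The HC axis modulo MARKMAN ALONE: row four -/

/-- **`HCUpToDim 5` MODULO MARKMAN'S FOURFOLD THEOREM ALONE IS THE ROW-FOUR RESIDUAL** (hypothesis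
`Markman2025_weilClasses_algebraic_abelianFourfold`; no Tankeev–Ribet, no Ribet, no `HC_CM`): the Hodge conjecture for
all complex abelian varieties of dimension `≤ 5` is EQUIVALENT to the Hodge conjecture on the simple non-CM FOURFOLDS
of none of the four types — Ribet `(3,1)`, minimal quaternion, maximal real multiplication, quartic CM `{(1,1),(2,0)}`
— [the rest of Moonen–Zarhin 1995]; clause (β) of `hcUpToDim_five_iff_rowFour_refined_and_generic_of_markman`
(the generic simple fivefolds) is closed by `genericSimpleFivefolds_hcOnClass`.
[cite: MoonenZarhin1999LowDim, Thm. 0.1, Thm. 0.2 and §2 Thm. (2.7)] [cite: MoonenZarhin1995Duke, Thm. 2.4]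
[cite: Ribet1983, Thms. 0–3] [claim: Markman2025SurveySecant, status: under-review] -/
theorem hcUpToDim_five_iff_rowFour_refined_of_markman (hMark : Markman2025_weilClasses_algebraic_abelianFourfold) :
    HCUpToDim 5 ↔ HCOnClass fun A => A.dim = 4 ∧ A.IsSimple ∧ ¬ IsOfCMType A ∧
      (¬ ∃ (φ : A ⟶ A) (d : ℕ), 0 < d ∧ φ ≫ φ = -(d • 𝟙 A) ∧ Module.finrank ℚ A.endAlgebra = 2 ∧
        (eigenMultiplicity A φ (Complex.I * (Real.sqrt d : ℂ)) = 1 ∨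
          eigenMultiplicity A φ (-(Complex.I * (Real.sqrt d : ℂ))) = 1)) ∧
      (¬ ∃ (K : Type) (_ : Field K) (_ : NumberField K) (_ : IsTotallyReal K) (_ : Algebra K A.endAlgebra)
        (_ : IsScalarTower ℚ K A.endAlgebra) (_ : IsQuaternionAlgebra K A.endAlgebra), A.dim = 2 * Module.finrank ℚ K) ∧
      (¬ ∃ hF : IsField A.endAlgebra, IsTotallyReal (EndField A hF) ∧ Module.finrank ℚ A.endAlgebra = A.dim) ∧
      (¬ ∃ (φ : A ⟶ A) (μ₁ μ₂ : ℂ), Module.finrank ℚ A.endAlgebra = 4 ∧ starRingEnd ℂ μ₁ ≠ μ₁ ∧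
        starRingEnd ℂ μ₂ ≠ μ₂ ∧ μ₂ ≠ μ₁ ∧ μ₂ ≠ starRingEnd ℂ μ₁ ∧ eigenMultiplicity A φ μ₁ = 1 ∧
        eigenMultiplicity A φ (starRingEnd ℂ μ₁) = 1 ∧ eigenMultiplicity A φ μ₂ = 2) := by
  rw [hcUpToDim_five_iff_rowFour_refined_and_generic_of_markman hMark]
  exact ⟨fun h => h.1, fun h => ⟨h, genericSimpleFivefolds_hcOnClass⟩⟩

/-- **On path**: the row-four residual class is a case of the summit. [cite: Deligne2000, §1] -/
theorem rowFourRefined_hcOnClass_of_hodgeConjecture (h : _root_.HodgeConjecture) :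
    HCOnClass fun A => A.dim = 4 ∧ A.IsSimple ∧ ¬ IsOfCMType A ∧
      (¬ ∃ (φ : A ⟶ A) (d : ℕ), 0 < d ∧ φ ≫ φ = -(d • 𝟙 A) ∧ Module.finrank ℚ A.endAlgebra = 2 ∧
        (eigenMultiplicity A φ (Complex.I * (Real.sqrt d : ℂ)) = 1 ∨
          eigenMultiplicity A φ (-(Complex.I * (Real.sqrt d : ℂ))) = 1)) ∧
      (¬ ∃ (K : Type) (_ : Field K) (_ : NumberField K) (_ : IsTotallyReal K) (_ : Algebra K A.endAlgebra)
        (_ : IsScalarTower ℚ K A.endAlgebra) (_ : IsQuaternionAlgebra K A.endAlgebra), A.dim = 2 * Module.finrank ℚ K) ∧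
      (¬ ∃ hF : IsField A.endAlgebra, IsTotallyReal (EndField A hF) ∧ Module.finrank ℚ A.endAlgebra = A.dim) ∧
      (¬ ∃ (φ : A ⟶ A) (μ₁ μ₂ : ℂ), Module.finrank ℚ A.endAlgebra = 4 ∧ starRingEnd ℂ μ₁ ≠ μ₁ ∧
        starRingEnd ℂ μ₂ ≠ μ₂ ∧ μ₂ ≠ μ₁ ∧ μ₂ ≠ starRingEnd ℂ μ₁ ∧ eigenMultiplicity A φ μ₁ = 1 ∧
        eigenMultiplicity A φ (starRingEnd ℂ μ₁) = 1 ∧ eigenMultiplicity A φ μ₂ = 2) :=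
  hcOnClass_of_hodgeConjecture _ h

/-! ### §3 (appended) The dimension-`≤ 5` reduction takes the FOURFOLD fact alone -/

/-- **The Moonen–Zarhin / Markman dimension-`≤ 5` reduction from the FOURFOLD FACT ALONE**: granted the codimension-two
part of Moonen–Zarhin's Thm. 0.1 (`MoonenZarhin1999_codimTwoHodgeClasses_abelianFourfold`: for abelian fourfolds
`B² ⊆ D² + Σ_k W_k`, a named fact of the tree — HYPOTHESIS, not discharged), the named fact
`MoonenZarhin1999_hodgeClasses_abelian_dim_le_five_of_weilClassesFourfolds` («algebraicity of the Weil classes of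
abelian fourfolds ⟹ algebraicity of every rational `(p,p)`-class on every complex abelian variety of dimension `≤ 5`»)
HOLDS: the Literature lane's `MoonenZarhin1999_hodgeClasses_abelian_dim_le_five_of_weilClassesFourfolds_of_printed`
(Lefschetz `(1,1)` from Kodaira–Serre sections and GAGA, hard Lefschetz, pull-backs — all theorems) fed with the
fivefold fact `moonenZarhin1999_codimTwoHodgeClasses_abelianFivefold_holds` (§1). What remains of that reduction is
exactly Thm. 0.1 in codimension two. [cite: MoonenZarhin1999LowDim, Thm. 0.1, Thm. 0.2 and (1.9)]
[cite: Markman2025SurveySecant, §1.1 and proof of Cor. 1.3] [cite: VoisinHodgeI2002, Thm. 11.30, Cor. 11.34 and Thm. 6.25] -/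
theorem moonenZarhin1999_hodgeClasses_abelian_dim_le_five_of_weilClassesFourfolds_of_fourfoldFact
    (h01 : MoonenZarhin1999_codimTwoHodgeClasses_abelianFourfold) :
    MoonenZarhin1999_hodgeClasses_abelian_dim_le_five_of_weilClassesFourfolds :=
  MoonenZarhin1999_hodgeClasses_abelian_dim_le_five_of_weilClassesFourfolds_of_printed h01
    moonenZarhin1999_codimTwoHodgeClasses_abelianFivefold_holds

/-- **Hence, granted the fourfold fact AND Markman's Weil-class theorem (both hypotheses), every rational
`(p,p)`-class on every complex abelian variety of dimension `≤ 5` is algebraic** (the conclusion fact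
`Markman2025_hodgeClasses_algebraic_abelian_dim_le_five`, unfolded from the reduction).
[cite: MoonenZarhin1999LowDim, Thm. 0.1 and Thm. 0.2] [claim: Markman2025SurveySecant, status: under-review] -/
theorem markman2025_hodgeClasses_algebraic_abelian_dim_le_five_of_fourfoldFact_of_markman
    (h01 : MoonenZarhin1999_codimTwoHodgeClasses_abelianFourfold)
    (hMark : Markman2025_weilClasses_algebraic_abelianFourfold) :
    Markman2025_hodgeClasses_algebraic_abelian_dim_le_five :=
  moonenZarhin1999_hodgeClasses_abelian_dim_le_five_of_weilClassesFourfolds_of_fourfoldFact h01 hMark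

end Summit.HodgeConjecture.Ring2.FivefoldFactHolds

end
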